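import Summits.CriticalPhenomena.CardyFormulaZ2.Theorems.CardyComplexConeEdgePrecompactVertexRelationPairSum
import Literature.Probability.LatticeModels.DartFlux
import HarnessLib

/-!
# The vertex relation at interior–wired-arc edges, I: the once/twice bookkeeping
(line `potential-darboux-picard-diamond` of crux `ParafermionToSLESixFamilies`, stmt-CriticalPhenomena-11389;
first helper file of the stub `stub_vertexRelationArcA` = S1v, `VertexRelationArcA` of `…DiamondDefs.lean`)

The landed `q = 1` half-Cauchy–Riemann vertex relation `cornerObs_vertexRelation`
(`…EdgePrecompactVertexRelation.lean`) is stated for an edge `e = cTgt p` of `Ω_δ` with BOTH endpoints off both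
discrete arcs, and its proof feeds "all four faces around both endpoints are inner"
(`forall_isInnerFace_of_not_mem_arcs`) into the combinatorial core (`vertexRelation_onceTwice` →
`vertexRelation_pairSum`, planar input `spliceLoop_turning_eq`). The stub S1v needs the relation at a fair-coin
edge with possibly ONE endpoint on the wired arc `A` (no endpoint on the free arc `B`, both faces of `e` inner),
where the faces away from `e` at the arc endpoint are not inner. Inspection of the chain shows that the strong
hypothesis is used only (i) for the two faces of `e` (the faces of `p` and of its partner), (ii) to know that the
far endpoint of `e` is off `B` (so that `p` is not the exit corner and the partner's loop cannot pivot around a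
`B`-site), and (iii) in case 0 of the pair identity, to separate the start corner from the corners leaving `e`
(again: the endpoints of `e` are off `B`, the start corner's vertex is on `B`). The Literature already re-ran the
case-1 rearrangement under exactly these weak hypotheses (`cornerOrbit_toggle_case1_free`, `DartFlux.lean`, for
Smirnov's Lemma 4.5 at all interior medial vertices). This file re-runs the once/twice bookkeeping
(`vertexRelation_onceTwice_arcA`, `pairSum_of_core_arcA`): the tree's proofs verbatim with the two hypotheses
`hx`, `hy` replaced by "the partner's face is inner" and "the far endpoint is off `B`".

References: S. Smirnov, Ann. of Math. 172 (2010), proof of Lemma 4.5 and Remark 4.7; H. Duminil-Copin, S. Smirnov,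
arXiv:1109.1549, §8, Prop. 8.6.
-/

namespace Summit.CriticalPhenomena.CardyFormulaZ2.Cruxes.ParafermionToSLESixFamilies.PotentialDarbouxPicardDiamond

open MeasureTheory Filter Set Metric
open scoped Topology BigOperators Pointwise
open Literature.Probability.LatticeModels Literature.Probability.Percolation
open Literature.Probability.RandomPlanarGeometry (DobrushinDomain)
open Summit.CriticalPhenomena.CardyFormulaZ2.Theses.CardyComplexCone
open Summit.CriticalPhenomena.CardyFormulaZ2.Cruxes.EdgePrecompact.QkzStripBoundaryArm

/-! ## The once/twice pair -/

/-- **The four pair sums of a once/twice pair, at an edge with possibly one wired-arc endpoint**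
(`vertexRelation_onceTwice` of the tree with "all faces at both endpoints of `e` inner" weakened to "the face
of the partner of `d` is inner and the far endpoint of `e = cTgt d` is off the free arc `B`"; the face of `d`
itself is inner because `d` is a dart of the path). Admissible data `E`, start corner `c₀`; two configurations
whose completions agree off `e` and differ at `e`; in the ONCE-configuration `ω₁` (exit time `N₁`) the corner
`d = orb i₁` is a dart and its partner is not; `Q` is the minimal period of the partner's cycle under `ω₁`,
ASSUMED to turn by `4 · turnSign d`; `N₂` is the exit time of `ω₂`. Then the sums over the two paths of
`φ (turnCount j)` over the visits `j` of `d`, of the two successors of `d`, and of the partner are `2 φ C`,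
`2 φ (C + σ)`, `φ (C − σ)`, `φ (C + 2σ)` (`C = turnCount i₁`, `σ = turnSign d`, both in `ω₁`). Proof: the
tree's proof verbatim, with `cornerOrbit_toggle_case1_free` (Literature `DartFlux.lean`) for
`cornerOrbit_toggle_case1`. -/
theorem vertexRelation_onceTwice_arcA : ∀ (φ : ℤ → ℂ) (E : DiscreteDobrushin), E.IsZdAdmissible → ∀ (ω₁ ω₂ : BondConfig (Site 2)) (c₀ d : Site 2 × Fin 4) (N₁ N₂ i₁ Q : ℕ), E.IsStartCorner c₀ → (∀ e', e' ≠ cTgt d → (e' ∈ E.bcBondConfig ω₂ ↔ e' ∈ E.bcBondConfig ω₁)) → ¬ (cTgt d ∈ E.bcBondConfig ω₂ ↔ cTgt d ∈ E.bcBondConfig ω₁) → E.IsInnerFace (cFace (cornerPartner d)) → d.1 + cornerUnit (d.2 + 1) ∉ E.zdArcB → ¬ E.IsInnerFace (cFace (cornerOrbit (E.bcBondConfig ω₁) c₀ N₁)) → (∀ k < N₁, E.IsInnerFace (cFace (cornerOrbit (E.bcBondConfig ω₁) c₀ k))) → ¬ E.IsInnerFace (cFace (cornerOrbit (E.bcBondConfig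 ω₂) c₀ N₂)) → (∀ k < N₂, E.IsInnerFace (cFace (cornerOrbit (E.bcBondConfig ω₂) c₀ k))) → cornerOrbit (E.bcBondConfig ω₁) c₀ i₁ = d → i₁ < N₁ → (∀ i < N₁, cornerOrbit (E.bcBondConfig ω₁) c₀ i ≠ cornerPartner d) → 0 < Q → cornerOrbit (E.bcBondConfig ω₁) (cornerPartner d) Q = cornerPartner d → (∀ s, 0 < s → s < Q → cornerOrbit (E.bcBondConfig ω₁) (cornerPartner d) s ≠ cornerPartner d) → ∑ m ∈ Finset.range Q, turnSign (E.bcBondConfig ω₁) (cornerOrbit (E.bcBondConfig ω₁) (cornerPartner d) m) = 4 * turnSign (E.bcBondConfig ω₁) d → (∑ j ∈ (Finset.range N₁).filter (fun j => cornerOrbit (E.bcBondConfig ω₁) c₀ j = d), φ (turnCount (E.bcBondConfig ω₁) c₀ j)) + (∑ j ∈ (Finset.range N₂).filter (fun j => cornerOrbit (E.bcBondConfig ω₂) c₀ j = d), φ (turnCount (E.bcBondConfig ω₂) c₀ j)) = 2 * φ (turnCount (E.bcBondConfig ω₁) c₀ i₁) ∧ (∑ j ∈ (Finset.range N₁).filter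 (fun j => cornerOrbit (E.bcBondConfig ω₁) c₀ j = nextCorner (E.bcBondConfig ω₁) d), φ (turnCount (E.bcBondConfig ω₁) c₀ j)) + (∑ j ∈ (Finset.range N₂).filter (fun j => cornerOrbit (E.bcBondConfig ω₂) c₀ j = nextCorner (E.bcBondConfig ω₁) d), φ (turnCount (E.bcBondConfig ω₂) c₀ j)) = 2 * φ (turnCount (E.bcBondConfig ω₁) c₀ i₁ + turnSign (E.bcBondConfig ω₁) d) ∧ (∑ j ∈ (Finset.range N₁).filter (fun j => cornerOrbit (E.bcBondConfig ω₁) c₀ j = nextCorner (E.bcBondConfig ω₂) d), φ (turnCount (E.bcBondConfig ω₁) c₀ j)) + (∑ j ∈ (Finset.range N₂).filter (fun j => cornerOrbit (E.bcBondConfig ω₂) c₀ j = nextCorner (E.bcBondConfig ω₂) d), φ (turnCount (E.bcBondConfig ω₂) c₀ j)) = φ (turnCount (E.bcBondConfig ω₁) c₀ i₁ - turnSign (E.bcBondConfig ω₁) d) ∧ (∑ j ∈ (Finset.range N₁).filter (fun j => cornerOrbit (E.bcBondConfig ω₁) c₀ j = cornerPartner d), φ (turnCount (E.bcBondConfig ω₁)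 c₀ j)) + (∑ j ∈ (Finset.range N₂).filter (fun j => cornerOrbit (E.bcBondConfig ω₂) c₀ j = cornerPartner d), φ (turnCount (E.bcBondConfig ω₂) c₀ j)) = φ (turnCount (E.bcBondConfig ω₁) c₀ i₁ + 2 * turnSign (E.bcBondConfig ω₁) d) := by
  intro φ E hE ω₁ ω₂ c₀ d N₁ N₂ i₁ Q hc₀ hagree hdiff hp₂f hyB hN₁ hlt₁ hN₂ hlt₂ hi₁ hi₁N h₂ hQ0 hQ hQmin hT
  classical
  have hstep : ∀ (β : BondConfig (Site 2)) (c : Site 2 × Fin 4) (i : ℕ),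
      cornerOrbit β c (i + 1) = nextCorner β (cornerOrbit β c i) := fun _ _ _ => rfl
  -- the far endpoint `y` of `e` is off the arc `B`, so `d` is not the last dart
  have hpf : E.IsInnerFace (cFace d) := hi₁ ▸ hlt₁ i₁ hi₁N
  have hi₁1 : i₁ + 1 < N₁ := by
    by_contra hcon
    have hN1 : N₁ = i₁ + 1 := by omega
    subst hN1
    obtain ⟨-, -, hB, -⟩ := cornerOrbit_exit hE hc₀ (n := i₁) (hlt₁ i₁ hi₁N) hN₁
    rw [hi₁] at hB
    exact hyB hB
  -- darts of the once-path are distinct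
  have hinj : ∀ a b, a < N₁ → b < N₁ → cornerOrbit (E.bcBondConfig ω₁) c₀ a = cornerOrbit (E.bcBondConfig ω₁) c₀ b → a = b := by
    intro a b ha hb h
    by_contra hne
    rcases Nat.lt_or_gt_of_ne hne with hab | hab
    · exact cornerOrbit_ne hE hc₀ hab (fun k hk => hlt₁ k (by omega)) h
    · exact cornerOrbit_ne hE hc₀ hab (fun k hk => hlt₁ k (by omega)) h.symm
  -- the interface orbit of `ω₁` is periodic; the partner's loop misses it entirely
  have hp₂in : E.IsInnerFace (cFace (cornerPartner d)) := hp₂f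
  have hc₀mesh : c₀.1 ∈ meshDomain E.Ω E.δ := fst_mem_meshDomain_of_isInnerFace (q := c₀) hc₀.isOutEdge.1
  have hexP : ∃ P, 0 < P ∧ cornerOrbit (E.bcBondConfig ω₁) c₀ P = c₀ := exists_cornerOrbit_period hE hc₀mesh
  have hP₀0 : 0 < Nat.find hexP := (Nat.find_spec hexP).1
  have hP₀ : cornerOrbit (E.bcBondConfig ω₁) c₀ (Nat.find hexP) = c₀ := (Nat.find_spec hexP).2
  have hP₀min : ∀ s, 0 < s → s < Nat.find hexP → cornerOrbit (E.bcBondConfig ω₁) c₀ s ≠ c₀ :=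
    fun s hs hsP h => Nat.find_min hexP hsP ⟨hs, h⟩
  have hdisj : ∀ m s, cornerOrbit (E.bcBondConfig ω₁) (cornerPartner d) m ≠ cornerOrbit (E.bcBondConfig ω₁) c₀ s := by
    intro m s h
    obtain ⟨s', hs'⟩ := exists_eq_cornerOrbit_of_iterate hP₀0 hP₀ m h
    have hin : E.IsInnerFace (cFace (cornerOrbit (E.bcBondConfig ω₁) c₀ s')) := hs' ▸ hp₂in
    rw [isInnerFace_cornerOrbit_iff hE hc₀ hN₁ hlt₁ hP₀0 hP₀ hP₀min] at hin
    exact h₂ _ hin (by rw [cornerOrbit_mod_period hP₀]; exact hs'.symm)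
  have hLinj : ∀ a b, a < Q → b < Q →
      cornerOrbit (E.bcBondConfig ω₁) (cornerPartner d) a = cornerOrbit (E.bcBondConfig ω₁) (cornerPartner d) b → a = b := by
    intro a b ha hb h
    by_contra hne
    rcases Nat.lt_or_gt_of_ne hne with hab | hab
    · obtain ⟨t, rfl⟩ := Nat.exists_eq_add_of_lt hab
      have := cornerOrbit_eq_of_add_eq (cornerPartner d) (i := 0) (j := t + 1) a
        (by rwa [zero_add, show t + 1 + a = a + t + 1 by omega])
      exact hQmin (t + 1) (Nat.succ_pos _) (by omega) this.symm
    · obtain ⟨t, rfl⟩ := Nat.exists_eq_add_of_lt hab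
      have := cornerOrbit_eq_of_add_eq (cornerPartner d) (i := 0) (j := t + 1) b
        (by rw [zero_add, show t + 1 + b = b + t + 1 by omega]; exact h.symm)
      exact hQmin (t + 1) (Nat.succ_pos _) (by omega) this.symm
  have hQ1 : 1 < Q := by
    by_contra h1
    have hQ1 : Q = 1 := by omega
    rw [hQ1] at hQ
    exact nextCorner_ne_self _ _ hQ
  -- the twice-path: prefix, loop, tail (case 1 of the rearrangement), exit at `N₁ + Q`
  obtain ⟨hpre, hloop, htail, hlt₂', hN₂'⟩ := cornerOrbit_toggle_case1_free hE hc₀ hagree hdiff hpf hp₂f hyB hN₁ hlt₁ hP₀0 hP₀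
    hP₀min hQ0 hQ hQmin hi₁ hi₁N h₂
  obtain rfl : N₂ = N₁ + Q := exit_unique hN₂ hlt₂ hN₂' hlt₂'
  have horb₂ : ∀ j < N₁ + Q, (j ≤ i₁ ∧ cornerOrbit (E.bcBondConfig ω₂) c₀ j = cornerOrbit (E.bcBondConfig ω₁) c₀ j) ∨
      (∃ m, 0 < m ∧ m ≤ Q ∧ j = i₁ + m ∧ cornerOrbit (E.bcBondConfig ω₂) c₀ j = cornerOrbit (E.bcBondConfig ω₁) (cornerPartner d) m) ∨
      (∃ t, i₁ + 1 + t < N₁ ∧ j = i₁ + Q + 1 + t ∧ cornerOrbit (E.bcBondConfig ω₂) c₀ j = cornerOrbit (E.bcBondConfig ω₁) c₀ (i₁ + 1 + t)) := by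
    intro j hj
    by_cases h1 : j ≤ i₁
    · exact Or.inl ⟨h1, hpre j h1⟩
    · by_cases h2 : j ≤ i₁ + Q
      · refine Or.inr (Or.inl ⟨j - i₁, by omega, by omega, by omega, ?_⟩)
        have := hloop (j - i₁ - 1) (by omega)
        rwa [show i₁ + 1 + (j - i₁ - 1) = j by omega, show j - i₁ - 1 + 1 = j - i₁ by omega] at this
      · refine Or.inr (Or.inr ⟨j - i₁ - Q - 1, by omega, by omega, ?_⟩)
        have := htail (j - i₁ - Q - 1) (by omega)
        rwa [show i₁ + Q + 1 + (j - i₁ - Q - 1) = j by omega] at this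
  -- target edges other than those of `d`, `d₂` are not `e`
  have htgt₁ : ∀ j < N₁, j ≠ i₁ → cTgt (cornerOrbit (E.bcBondConfig ω₁) c₀ j) ≠ cTgt d := by
    intro j hj hji h
    rcases cTgt_eq_cTgt_iff.1 h with h | h
    · exact hji (hinj j i₁ hj hi₁N (h.trans hi₁.symm))
    · exact h₂ j hj h
  have htgtL : ∀ m, 0 < m → m < Q → cTgt (cornerOrbit (E.bcBondConfig ω₁) (cornerPartner d) m) ≠ cTgt d := by
    intro m hm hmQ h
    rcases cTgt_eq_cTgt_iff.1 h with h | h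
    · exact hdisj m i₁ (h.trans hi₁.symm)
    · exact hQmin m hm hmQ h
  -- turn signs and turn counts
  have hσ₂ : turnSign (E.bcBondConfig ω₂) d = -turnSign (E.bcBondConfig ω₁) d := turnSign_toggle hdiff
  have hσ₂' : turnSign (E.bcBondConfig ω₂) (cornerPartner d) = -turnSign (E.bcBondConfig ω₁) d := by
    rw [← turnSign_partner (E.bcBondConfig ω₁) d]
    exact turnSign_toggle (by rwa [cTgt_partner])
  have hC₁ : turnCount (E.bcBondConfig ω₂) c₀ i₁ = turnCount (E.bcBondConfig ω₁) c₀ i₁ :=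
    turnCount_congr_prefix (fun j hj => hpre j hj) (fun j hj => hagree _ (htgt₁ j (by omega) (by omega)))
  have hC₁b : turnCount (E.bcBondConfig ω₁) c₀ (i₁ + 1) = turnCount (E.bcBondConfig ω₁) c₀ i₁ + turnSign (E.bcBondConfig ω₁) d := by
    rw [turnCount_succ, hi₁]
  have hC₂a : turnCount (E.bcBondConfig ω₂) c₀ (i₁ + 1) = turnCount (E.bcBondConfig ω₁) c₀ i₁ - turnSign (E.bcBondConfig ω₁) d := by
    rw [turnCount_succ, hC₁, hpre i₁ le_rfl, hi₁, hσ₂]; ring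
  have hC₂b : turnCount (E.bcBondConfig ω₂) c₀ (i₁ + Q) = turnCount (E.bcBondConfig ω₁) c₀ i₁ + 2 * turnSign (E.bcBondConfig ω₁) d := by
    have hadd := turnCount_add (E.bcBondConfig ω₂) c₀ (i₁ + 1) (Q - 1)
    rw [show i₁ + 1 + (Q - 1) = i₁ + Q by omega] at hadd
    have hsum : ∑ m ∈ Finset.range (Q - 1), turnSign (E.bcBondConfig ω₂) (cornerOrbit (E.bcBondConfig ω₂) c₀ (i₁ + 1 + m)) =
        ∑ m ∈ Finset.range (Q - 1), turnSign (E.bcBondConfig ω₁) (cornerOrbit (E.bcBondConfig ω₁) (cornerPartner d) (m + 1)) := by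
      refine Finset.sum_congr rfl fun m hm => ?_
      rw [Finset.mem_range] at hm
      rw [hloop m (by omega)]
      exact turnSign_congr (hagree _ (htgtL (m + 1) (Nat.succ_pos _) (by omega)))
    have hT' : ∑ m ∈ Finset.range Q, turnSign (E.bcBondConfig ω₁) (cornerOrbit (E.bcBondConfig ω₁) (cornerPartner d) m) =
        ∑ m ∈ Finset.range (Q - 1), turnSign (E.bcBondConfig ω₁) (cornerOrbit (E.bcBondConfig ω₁) (cornerPartner d) (m + 1)) +
          turnSign (E.bcBondConfig ω₁) d := by
      conv_lhs => rw [show Q = Q - 1 + 1 by omega, Finset.sum_range_succ']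
      rw [← turnSign_partner (E.bcBondConfig ω₁) d]
      rfl
    rw [hadd, hsum, hC₂a]
    rw [hT'] at hT
    linear_combination hT
  have horbQ : cornerOrbit (E.bcBondConfig ω₂) c₀ (i₁ + Q) = cornerPartner d := by
    have := hloop (Q - 1) (by omega)
    rwa [show i₁ + 1 + (Q - 1) = i₁ + Q by omega, show Q - 1 + 1 = Q by omega, hQ] at this
  have hC₂c : turnCount (E.bcBondConfig ω₂) c₀ (i₁ + Q + 1) = turnCount (E.bcBondConfig ω₁) c₀ i₁ + turnSign (E.bcBondConfig ω₁) d := by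
    rw [turnCount_succ, hC₂b, horbQ, hσ₂']; ring
  -- the successors of `d`
  have hn₂ : nextCorner (E.bcBondConfig ω₂) d = cornerOrbit (E.bcBondConfig ω₁) (cornerPartner d) 1 := by
    rw [nextCorner_toggle hagree hdiff, Equiv.swap_apply_left]; rfl
  have hn₁ : nextCorner (E.bcBondConfig ω₁) d = cornerOrbit (E.bcBondConfig ω₁) c₀ (i₁ + 1) := by rw [hstep, hi₁]
  -- positions on the twice-path
  have horb₂i₁ : cornerOrbit (E.bcBondConfig ω₂) c₀ i₁ = d := (hpre i₁ le_rfl).trans hi₁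
  have horb₂n₂ : cornerOrbit (E.bcBondConfig ω₂) c₀ (i₁ + 1) = nextCorner (E.bcBondConfig ω₂) d := by
    rw [hn₂]; exact hloop 0 (by omega)
  have horb₂n₁ : cornerOrbit (E.bcBondConfig ω₂) c₀ (i₁ + Q + 1) = nextCorner (E.bcBondConfig ω₁) d := by
    rw [hn₁]; exact htail 0 (by omega)
  -- uniqueness of the positions on the twice-path
  have huniq_d : ∀ j < N₁ + Q, cornerOrbit (E.bcBondConfig ω₂) c₀ j = d → j = i₁ := by
    intro j hj h
    rcases horb₂ j hj with ⟨hji, hj'⟩ | ⟨m, hm0, hmQ, rfl, hj'⟩ | ⟨t, ht, rfl, hj'⟩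
    · exact hinj j i₁ (by omega) hi₁N ((hj'.symm.trans h).trans hi₁.symm)
    · exact absurd ((hj'.symm.trans h).trans hi₁.symm) (hdisj m i₁)
    · have := hinj _ _ ht hi₁N ((hj'.symm.trans h).trans hi₁.symm); omega
  have huniq_n₂ : ∀ j < N₁ + Q, cornerOrbit (E.bcBondConfig ω₂) c₀ j = nextCorner (E.bcBondConfig ω₂) d → j = i₁ + 1 := by
    intro j hj h
    rw [hn₂] at h
    rcases horb₂ j hj with ⟨hji, hj'⟩ | ⟨m, hm0, hmQ, rfl, hj'⟩ | ⟨t, ht, rfl, hj'⟩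
    · exact absurd (hj'.symm.trans h).symm (hdisj 1 j)
    · rcases Nat.lt_or_ge m Q with hmQ' | hmQ'
      · have := hLinj m 1 hmQ' hQ1 (hj'.symm.trans h); omega
      · have hmQ'' : m = Q := le_antisymm hmQ hmQ'
        subst hmQ''
        rw [hQ] at hj'
        have := hLinj 0 1 hQ0 hQ1 (hj'.symm.trans h)
        omega
    · exact absurd (hj'.symm.trans h).symm (hdisj 1 _)
  have huniq_d₂ : ∀ j < N₁ + Q, cornerOrbit (E.bcBondConfig ω₂) c₀ j = cornerPartner d → j = i₁ + Q := by
    intro j hj h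
    rcases horb₂ j hj with ⟨hji, hj'⟩ | ⟨m, hm0, hmQ, rfl, hj'⟩ | ⟨t, ht, rfl, hj'⟩
    · exact absurd (hj'.symm.trans h) (h₂ j (by omega))
    · rcases Nat.lt_or_ge m Q with hmQ' | hmQ'
      · exact absurd (hj'.symm.trans h) (hQmin m hm0 hmQ')
      · omega
    · exact absurd (hj'.symm.trans h) (h₂ _ ht)
  have huniq_n₁ : ∀ j < N₁ + Q, cornerOrbit (E.bcBondConfig ω₂) c₀ j = nextCorner (E.bcBondConfig ω₁) d → j = i₁ + Q + 1 := by
    intro j hj h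
    rw [hn₁] at h
    rcases horb₂ j hj with ⟨hji, hj'⟩ | ⟨m, hm0, hmQ, rfl, hj'⟩ | ⟨t, ht, rfl, hj'⟩
    · have := hinj j (i₁ + 1) (by omega) hi₁1 (hj'.symm.trans h); omega
    · exact absurd (hj'.symm.trans h) (hdisj m (i₁ + 1))
    · have := hinj _ _ ht hi₁1 (hj'.symm.trans h); omega
  -- evaluate the eight sums
  have e1 := sum_filter_eq_single (Finset.range N₁) (fun j => cornerOrbit (E.bcBondConfig ω₁) c₀ j = d)
    (fun j => φ (turnCount (E.bcBondConfig ω₁) c₀ j)) (Finset.mem_range.2 hi₁N) hi₁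
    (fun j hj h => hinj j i₁ (Finset.mem_range.1 hj) hi₁N (h.trans hi₁.symm))
  have e2 := sum_filter_eq_single (Finset.range (N₁ + Q)) (fun j => cornerOrbit (E.bcBondConfig ω₂) c₀ j = d)
    (fun j => φ (turnCount (E.bcBondConfig ω₂) c₀ j)) (Finset.mem_range.2 (by omega)) horb₂i₁
    (fun j hj h => huniq_d j (Finset.mem_range.1 hj) h)
  have e3 := sum_filter_eq_single (Finset.range N₁) (fun j => cornerOrbit (E.bcBondConfig ω₁) c₀ j = nextCorner (E.bcBondConfig ω₁) d)
    (fun j => φ (turnCount (E.bcBondConfig ω₁) c₀ j)) (Finset.mem_range.2 hi₁1) hn₁.symm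
    (fun j hj h => hinj j (i₁ + 1) (Finset.mem_range.1 hj) hi₁1 (h.trans hn₁))
  have e4 := sum_filter_eq_single (Finset.range (N₁ + Q)) (fun j => cornerOrbit (E.bcBondConfig ω₂) c₀ j = nextCorner (E.bcBondConfig ω₁) d)
    (fun j => φ (turnCount (E.bcBondConfig ω₂) c₀ j)) (Finset.mem_range.2 (by omega)) horb₂n₁
    (fun j hj h => huniq_n₁ j (Finset.mem_range.1 hj) h)
  have e5 := sum_filter_eq_zero_of_forall_not (Finset.range N₁) (fun j => cornerOrbit (E.bcBondConfig ω₁) c₀ j = nextCorner (E.bcBondConfig ω₂) d)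
    (fun j => φ (turnCount (E.bcBondConfig ω₁) c₀ j)) (fun j _ h => hdisj 1 j (by rw [← hn₂, h]))
  have e6 := sum_filter_eq_single (Finset.range (N₁ + Q)) (fun j => cornerOrbit (E.bcBondConfig ω₂) c₀ j = nextCorner (E.bcBondConfig ω₂) d)
    (fun j => φ (turnCount (E.bcBondConfig ω₂) c₀ j)) (Finset.mem_range.2 (by omega)) horb₂n₂
    (fun j hj h => huniq_n₂ j (Finset.mem_range.1 hj) h)
  have e7 := sum_filter_eq_zero_of_forall_not (Finset.range N₁) (fun j => cornerOrbit (E.bcBondConfig ω₁) c₀ j = cornerPartner d)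
    (fun j => φ (turnCount (E.bcBondConfig ω₁) c₀ j)) (fun j hj h => h₂ j (Finset.mem_range.1 hj) h)
  have e8 := sum_filter_eq_single (Finset.range (N₁ + Q)) (fun j => cornerOrbit (E.bcBondConfig ω₂) c₀ j = cornerPartner d)
    (fun j => φ (turnCount (E.bcBondConfig ω₂) c₀ j)) (Finset.mem_range.2 (by omega)) horbQ
    (fun j hj h => huniq_d₂ j (Finset.mem_range.1 hj) h)
  rw [e1, e2, e3, e4, e5, e6, e7, e8, hC₁, hC₁b, hC₂c, hC₂a, hC₂b]
  refine ⟨by ring, by ring, by ring, by ring⟩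

/-! ## From the once/twice sums to the pair identity -/

/-- The pair identity for a once/twice pair at an edge with possibly one wired-arc endpoint, the
once-configuration FIRST (hypotheses of `vertexRelation_onceTwice_arcA`; `pairSum_of_core` of the tree under the
weakened hypotheses, same two ring identities `alg_pos` / `alg_neg`). -/
theorem pairSum_of_core_arcA : ∀ (φ : ℤ → ℂ), (∀ m n, φ (m + n) = φ m * φ n) → 2 * φ 1 - φ (-1) = Complex.I * (φ 2 - 2) → φ 1 - 2 * φ (-1) = Complex.I * (φ (-2) - 2) → ∀ (E : DiscreteDobrushin), E.IsZdAdmissible → ∀ (ω₁ ω₂ : BondConfig (Site 2)) (c₀ d : Site 2 × Fin 4) (N₁ N₂ i₁ Q : ℕ), E.IsStartCorner c₀ → (∀ e', e' ≠ cTgt d → (e' ∈ E.bcBondConfig ω₂ ↔ e' ∈ E.bcBondConfig ω₁)) → ¬ (cTgt d ∈ E.bcBondConfig ω₂ ↔ cTgt d ∈ E.bcBondConfig ω₁) → E.IsInnerFace (cFace (cornerPartner d)) → d.1 + cornerUnit (d.2 + 1) ∉ E.zdArcB → ¬ E.IsInnerFace (cFace (cornerOrbit (E.bcBondConfig ω₁)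 c₀ N₁)) → (∀ k < N₁, E.IsInnerFace (cFace (cornerOrbit (E.bcBondConfig ω₁) c₀ k))) → ¬ E.IsInnerFace (cFace (cornerOrbit (E.bcBondConfig ω₂) c₀ N₂)) → (∀ k < N₂, E.IsInnerFace (cFace (cornerOrbit (E.bcBondConfig ω₂) c₀ k))) → cornerOrbit (E.bcBondConfig ω₁) c₀ i₁ = d → i₁ < N₁ → (∀ i < N₁, cornerOrbit (E.bcBondConfig ω₁) c₀ i ≠ cornerPartner d) → 0 < Q → cornerOrbit (E.bcBondConfig ω₁) (cornerPartner d) Q = cornerPartner d → (∀ s, 0 < s → s < Q → cornerOrbit (E.bcBondConfig ω₁) (cornerPartner d) s ≠ cornerPartner d) → ∑ m ∈ Finset.range Q, turnSign (E.bcBondConfig ω₁) (cornerOrbit (E.bcBondConfig ω₁) (cornerPartner d) m) = 4 * turnSign (E.bcBondConfig ω₁) d → ((∑ j ∈ (Finset.range N₁).filter (fun j => cornerOrbit (E.bcBondConfig ω₁) c₀ j = (d.1, d.2 + 1)), φ (turnCount (E.bcBondConfig ω₁) c₀ j)) + (∑ j ∈ (Finset.range N₂).filter (fun j => cornerOrbit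 (E.bcBondConfig ω₂) c₀ j = (d.1, d.2 + 1)), φ (turnCount (E.bcBondConfig ω₂) c₀ j))) - ((∑ j ∈ (Finset.range N₁).filter (fun j => cornerOrbit (E.bcBondConfig ω₁) c₀ j = (d.1 + cornerUnit (d.2 + 1), d.2 + 3)), φ (turnCount (E.bcBondConfig ω₁) c₀ j)) + (∑ j ∈ (Finset.range N₂).filter (fun j => cornerOrbit (E.bcBondConfig ω₂) c₀ j = (d.1 + cornerUnit (d.2 + 1), d.2 + 3)), φ (turnCount (E.bcBondConfig ω₂) c₀ j))) - Complex.I * (((∑ j ∈ (Finset.range N₁).filter (fun j => cornerOrbit (E.bcBondConfig ω₁) c₀ j = cornerPartner d), φ (turnCount (E.bcBondConfig ω₁) c₀ j)) + (∑ j ∈ (Finset.range N₂).filter (fun j => cornerOrbit (E.bcBondConfig ω₂) c₀ j = cornerPartner d), φ (turnCount (E.bcBondConfig ω₂) c₀ j))) - ((∑ j ∈ (Finset.range N₁).filter (fun j => cornerOrbit (E.bcBondConfig ω₁) c₀ j = d), φ (turnCount (E.bcBondConfig ω₁) c₀ j)) + (∑ j ∈ (Finset.range N₂).filter (fun j =>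 cornerOrbit (E.bcBondConfig ω₂) c₀ j = d), φ (turnCount (E.bcBondConfig ω₂) c₀ j)))) = 0 := by
  intro φ hφ hI1 hI2 E hE ω₁ ω₂ c₀ d N₁ N₂ i₁ Q hc₀ hagree hdiff hp₂f hyB hN₁ hlt₁ hN₂ hlt₂ hi₁ hi₁N h₂ hQ0 hQ hQmin hT
  obtain ⟨h1, h2, h3, h4⟩ := vertexRelation_onceTwice_arcA φ E hE ω₁ ω₂ c₀ d N₁ N₂ i₁ Q hc₀ hagree hdiff hp₂f hyB hN₁
    hlt₁ hN₂ hlt₂ hi₁ hi₁N h₂ hQ0 hQ hQmin hT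
  by_cases hm : cTgt d ∈ E.bcBondConfig ω₁
  · have hm' : cTgt d ∉ E.bcBondConfig ω₂ := fun h => hdiff ⟨fun _ => hm, fun _ => h⟩
    rw [nextCorner_of_mem hm] at h2
    rw [nextCorner_of_not_mem hm'] at h3
    rw [turnSign_of_mem hm] at h2 h3 h4
    exact alg_neg φ hφ hI2 h1 h2 h3 h4
  · have hm' : cTgt d ∈ E.bcBondConfig ω₂ := by
      by_contra h
      exact hdiff ⟨fun h' => absurd h' h, fun h' => absurd h' hm⟩
    rw [nextCorner_of_not_mem hm] at h2
    rw [nextCorner_of_mem hm'] at h3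
    rw [turnSign_of_not_mem hm] at h2 h3 h4
    exact alg_pos φ hφ hI1 h1 h2 h3 h4

end Summit.CriticalPhenomena.CardyFormulaZ2.Cruxes.ParafermionToSLESixFamilies.PotentialDarbouxPicardDiamond
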